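import Mathlib
import Literature.NumberTheory.LFunctions.WeilGroundState
import Literature.NumberTheory.LFunctions.WeilGroundStateRealZerosProofs
import Summits.RiemannHypothesis.RiemannHypothesis.Theorems.WeilGroundStateGroundStateSimpleEvenStubIntertwineKernel
import Summits.RiemannHypothesis.RiemannHypothesis.Theorems.WeilGroundStateGroundStateSimpleEvenStubIntertwineOddPart
import Summits.RiemannHypothesis.RiemannHypothesis.Theorems.WeilGroundStateGroundStateSimpleEvenStubIntertwineApprox
import HarnessLib

/-!
# Crux `GroundStateSimpleEven` (stmt-RiemannHypothesis-1526), line `parity-multiplicity-commutator`: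
# stub INTERTWINE `stub_oddMinimisers_of_edgeCancelledPair`

`--supports stmt-RiemannHypothesis-1526`; proves the registered stub
`stub_oddMinimisers_of_edgeCancelledPair` of the skeleton of line `parity-multiplicity-commutator`
verbatim.  Normalisation of `Literature/NumberTheory/LFunctions/WeilExplicit.lean`:
`W = weilFunctional`, `Q g = W(g ⋆ g̃)`, `ε(a) = weilGroundEnergy a`,
`q(f) = Re Q(f) − ε(a)∫|f|²` (`≥ 0` on window test functions); ground states
`IsWeilGroundState a u` as in `WeilGroundState.lean`.

## Statement

Let `u₁, u₂` be EVEN ground states at window `a > 0` with `∫ conj u₁ · u₂ = 0`, and let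
`c₁, c₂, H, hₙ` be the data of the edge lemma `stub_evenPair_edgeCancellation`: `(c₁, c₂) ≠ 0`,
`H ∈ L²` vanishing a.e. off `[-a, a]`, `∫ H = 0`, `c₂u₁ − c₁u₂ = ∫_{-a}^t H` a.e., and window test
functions `hₙ → H` in `L²` with `Re Q(hₙ − hₘ) → 0`.  Then there is an ODD, `L²`-normalised
minimising sequence of window test functions `oₙ`: `Re Q(oₙ) → ε(a)`.

## Proof (continuum Connes–van Suijlekom Lemma 5.1/5.2, arXiv:2511.23257, no boundary term)

1. `q(hₙ) → 0` (helper 4, `tendsto_shiftedForm_approximants`): the weak Euler–Lagrange equation of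
   `c₂u₁ − c₁u₂` passes through `d/dt` by the kernel identity `W(P' ⋆ ψ̃) = −W(P ⋆ (ψ')̃)` to
   `W(hₙ ⋆ ψ̃) → ε ∫ H conj ψ`, and Cauchy–Schwarz for `q` does the rest.
2. Odd symmetrisation `oₙ' = ½(hₙ − hₙ(-·))`: `0 ≤ q(oₙ') ≤ q(hₙ) → 0` (parity splitting, helper 2
   `shiftedForm_oddPart_le`) and `∫|oₙ'|² → ∫|H_o|²`, `H_o = ½(H − H(-·))` (odd parts are
   `L²`-contractions, helper 3).
3. `∫|H_o|² > 0` (helper 3, `integral_norm_sq_oddPart_pos`: otherwise the odd continuous primitive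
   `∫_{-a}^t H` agrees a.e. with the even `c₂u₁ − c₁u₂`, forcing `c₁ = c₂ = 0`).
4. Normalise `oₙ = oₙ'/‖oₙ'‖₂` from the index on where `∫|oₙ'|² > ½∫|H_o|²`:
   `Re Q(oₙ) = Re Q(oₙ')/∫|oₙ'|² → ε(a)`.

Mathlib + proved tree files only; no definitions, no named facts.
-/

noncomputable section

open Set MeasureTheory Filter Complex
open scoped Real Topology ComplexConjugate

namespace Summit.RiemannHypothesis.RiemannHypothesis.Theorems.GroundStateSimpleEven

open Literature.NumberTheory.LFunctions

-- `linter.dupNamespace` off: the mandated namespace `Summit.RiemannHypothesis.RiemannHypothesis.…`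
-- (single-problem summit) repeats a component.
set_option linter.dupNamespace false

section Assembly

variable {a : ℝ} {u₁ u₂ H : ℝ → ℂ} {c₁ c₂ : ℂ} {h : ℕ → ℝ → ℂ}

/-- **Odd near-minimisers from the EDGE data.** In the setting of the module docstring, the odd
parts `oₙ' = ½(hₙ − hₙ(-·))` of the approximants are odd window test functions with
`Re Q(oₙ') → ε(a) ν` and `∫|oₙ'|² → ν`, where `ν = ∫|½(H − H(-·))|² > 0`. [folklore] -/
theorem oddParts_tendsto (hu₁ : IsWeilGroundState a u₁) (hu₂ : IsWeilGroundState a u₂)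
    (hev₁ : ∀ t, u₁ (-t) = u₁ t) (hev₂ : ∀ t, u₂ (-t) = u₂ t)
    (horth : ∫ t, starRingEnd ℂ (u₁ t) * u₂ t = 0) (hc : c₁ ≠ 0 ∨ c₂ ≠ 0) (hH : MemLp H 2)
    (hHz : ∀ᵐ t : ℝ, t ∉ Icc (-a) a → H t = 0) (hH0 : ∫ t, H t = 0)
    (hprim : ∀ᵐ t : ℝ, c₂ * u₁ t - c₁ * u₂ t = ∫ s in (-a)..t, H s)
    (hh : ∀ n, IsWeilTest (h n) ∧ tsupport (h n) ⊆ Icc (-a) a)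
    (hL : Tendsto (fun n ↦ ∫ t, ‖h n t - H t‖ ^ 2) atTop (𝓝 0))
    (hC : ∀ η : ℝ, 0 < η → ∃ N : ℕ, ∀ n m : ℕ, N ≤ n → N ≤ m →
      (weilQuadratic (h n - h m)).re < η) :
    0 < ∫ t, ‖(H t - H (-t)) / 2‖ ^ 2 ∧
    Tendsto (fun n ↦ ∫ t, ‖(h n t - h n (-t)) / 2‖ ^ 2) atTop
      (𝓝 (∫ t, ‖(H t - H (-t)) / 2‖ ^ 2)) ∧
    Tendsto (fun n ↦ (weilQuadratic fun t ↦ (h n t - h n (-t)) / 2).re) atTop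
      (𝓝 (weilGroundEnergy a * ∫ t, ‖(H t - H (-t)) / 2‖ ^ 2)) := by
  set ε : ℝ := weilGroundEnergy a with hε
  have hhm : ∀ n, MemLp (h n) 2 := fun n ↦ ConnesVanSuijlekom.isWeilTest_memLp (hh n).1
  have ho't : ∀ n, IsWeilTest fun t ↦ (h n t - h n (-t)) / 2 := fun n ↦ isWeilTest_oddPart' (hh n).1
  have ho's : ∀ n, tsupport (fun t ↦ (h n t - h n (-t)) / 2) ⊆ Icc (-a) a := fun n ↦
    tsupport_oddPart_subset (hh n).2
  have hνpos : 0 < ∫ t, ‖(H t - H (-t)) / 2‖ ^ 2 :=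
    integral_norm_sq_oddPart_pos hu₁ hu₂ hev₁ hev₂ horth hc hH hHz hH0 hprim
  -- norms converge
  have hN : Tendsto (fun n ↦ ∫ t, ‖(h n t - h n (-t)) / 2‖ ^ 2) atTop
      (𝓝 (∫ t, ‖(H t - H (-t)) / 2‖ ^ 2)) :=
    ConnesVanSuijlekom.tendsto_integral_norm_sq (memLp_two_oddPart hH)
      (fun n ↦ ConnesVanSuijlekom.isWeilTest_memLp (ho't n)) (tendsto_integral_norm_sq_oddPart hH hhm hL)
  -- shifted forms of the odd parts vanish
  have hq := tendsto_shiftedForm_approximants hu₁ hu₂ hH hHz hH0 hprim hh hL hC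
  have hqo : Tendsto (fun n ↦ (weilQuadratic fun t ↦ (h n t - h n (-t)) / 2).re -
      ε * ∫ t, ‖(h n t - h n (-t)) / 2‖ ^ 2) atTop (𝓝 0) :=
    tendsto_of_tendsto_of_tendsto_of_le_of_le tendsto_const_nhds hq
      (fun n ↦ by
        have := ConnesVanSuijlekom.weilGroundEnergy_mul_le_re (ho't n) (ho's n)
        simp only
        linarith)
      (fun n ↦ shiftedForm_oddPart_le (hh n).1 (hh n).2)
  refine ⟨hνpos, hN, ?_⟩
  have h1 := hqo.add (hN.const_mul ε)
  rw [zero_add] at h1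
  exact h1.congr fun n ↦ by ring

end Assembly

end Summit.RiemannHypothesis.RiemannHypothesis.Theorems.GroundStateSimpleEven

namespace Summit.RiemannHypothesis.RiemannHypothesis.Theorems

open Literature.NumberTheory.LFunctions
open Summit.RiemannHypothesis.RiemannHypothesis.Theorems.GroundStateSimpleEven

set_option linter.dupNamespace false in
/-- **STUB INTERTWINE (`d/dt` maps an edge-cancelled even eigen-combination to odd minimisers).**
With `a, u₁, u₂` as in EDGE and its data `c₁, c₂, H, hₙ`: there is an ODD `L²`-normalised
minimising sequence of window test functions, `Re Q(oₙ) → ε(a)`. Mechanism (the continuum form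
of Connes–van Suijlekom Lemma 5.1/5.2, arXiv:2511.23257, with the boundary term absent because
the combination vanishes at `±a`): the weak Euler–Lagrange equation for `u₁, u₂`
(`IsWeilGroundState.exists_eulerLagrange`) and linearity give it for `G = c₂u₁ − c₁u₂` along every
approximating sequence; window primitives and the kernel identity `W(P' ⋆ ψ̃) = −W(P ⋆ (ψ')̃)`
give `W(hₙ ⋆ ψ̃) → ε(a) ∫ H conj ψ` for window tests `ψ`; with the form-Cauchy approximants and
Cauchy–Schwarz for `q = Re Q − ε(a)‖·‖²` (`ConnesVanSuijlekom.abs_polar_le`), `q(hₙ) → 0`; the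
odd part of `H` is non-zero by orthonormality and evenness of `u₁, u₂`; odd-symmetrise and
normalise. [folklore] -/
theorem stub_oddMinimisers_of_edgeCancelledPair :
    ∀ a : ℝ, 0 < a → ∀ u₁ u₂ : ℝ → ℂ, IsWeilGroundState a u₁ → IsWeilGroundState a u₂ →
      (∀ t, u₁ (-t) = u₁ t) → (∀ t, u₂ (-t) = u₂ t) → ∫ t, starRingEnd ℂ (u₁ t) * u₂ t = 0 →
      ∀ c₁ c₂ : ℂ, (c₁ ≠ 0 ∨ c₂ ≠ 0) → ∀ H : ℝ → ℂ, MemLp H 2 →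
        (∀ᵐ t : ℝ, t ∉ Icc (-a) a → H t = 0) → ∫ t, H t = 0 →
        (∀ᵐ t : ℝ, c₂ * u₁ t - c₁ * u₂ t = ∫ s in (-a)..t, H s) →
        (∃ h : ℕ → ℝ → ℂ, (∀ n, IsWeilTest (h n) ∧ tsupport (h n) ⊆ Icc (-a) a) ∧
          Tendsto (fun n => ∫ t, ‖h n t - H t‖ ^ 2) atTop (𝓝 0) ∧
          ∀ η : ℝ, 0 < η → ∃ N : ℕ, ∀ n m : ℕ, N ≤ n → N ≤ m →
            (weilQuadratic (h n - h m)).re < η) →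
        ∃ o : ℕ → ℝ → ℂ, (∀ n, IsWeilTest (o n) ∧ tsupport (o n) ⊆ Icc (-a) a ∧
          ∫ t, ‖o n t‖ ^ 2 = (1 : ℝ) ∧ ∀ t, o n (-t) = -o n t) ∧
          Tendsto (fun n => (weilQuadratic (o n)).re) atTop (𝓝 (weilGroundEnergy a)) := by
  intro a ha u₁ u₂ hu₁ hu₂ hev₁ hev₂ horth c₁ c₂ hc H hH hHz hH0 hprim hdata
  obtain ⟨h, hh, hL, hC⟩ := hdata
  set ε : ℝ := weilGroundEnergy a with hε
  obtain ⟨hνpos, hN, hQ⟩ :=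
    oddParts_tendsto hu₁ hu₂ hev₁ hev₂ horth hc hH hHz hH0 hprim hh hL hC
  set ν : ℝ := ∫ t, ‖(H t - H (-t)) / 2‖ ^ 2 with hν
  set o' : ℕ → ℝ → ℂ := fun n t ↦ (h n t - h n (-t)) / 2 with ho'
  set Nn : ℕ → ℝ := fun n ↦ ∫ t, ‖o' n t‖ ^ 2 with hNn
  have ho't : ∀ n, IsWeilTest (o' n) := fun n ↦ isWeilTest_oddPart' (hh n).1
  have ho's : ∀ n, tsupport (o' n) ⊆ Icc (-a) a := fun n ↦ tsupport_oddPart_subset (hh n).2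
  have ho'odd : ∀ n t, o' n (-t) = -o' n t := fun n t ↦ by
    simp only [ho', neg_neg]
    ring
  -- from some index on, `∫|oₙ'|² > ν/2 > 0`
  obtain ⟨N₀, hN₀⟩ := eventually_atTop.1 (hN.eventually (lt_mem_nhds (show ν / 2 < ν by linarith)))
  have hpos : ∀ n, 0 < Nn (n + N₀) := fun n ↦ by
    have h1 := hN₀ (n + N₀) (Nat.le_add_left _ _)
    have h2 : Nn (n + N₀) = ∫ t, ‖(h (n + N₀) t - h (n + N₀) (-t)) / 2‖ ^ 2 := rfl
    linarith
  refine ⟨fun n t ↦ (((√(Nn (n + N₀)))⁻¹ : ℝ) : ℂ) * o' (n + N₀) t, fun n ↦ ⟨?_, ?_, ?_, ?_⟩, ?_⟩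
  · exact (ho't _).const_mul _
  · exact tsupport_mul_subset_right.trans (ho's _)
  · simp only [norm_mul, mul_pow, Complex.norm_real, Real.norm_of_nonneg
      (inv_nonneg.2 (Real.sqrt_nonneg _))]
    rw [integral_const_mul, inv_pow, Real.sq_sqrt (hpos n).le]
    exact inv_mul_cancel₀ (hpos n).ne'
  · intro t
    beta_reduce
    rw [ho'odd, mul_neg]
  · have h1 : ∀ n, (weilQuadratic fun t ↦ (((√(Nn (n + N₀)))⁻¹ : ℝ) : ℂ) * o' (n + N₀) t).re =
        (weilQuadratic (o' (n + N₀))).re / Nn (n + N₀) := by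
      intro n
      rw [weilQuadratic_const_mul, Complex.normSq_ofReal, Complex.re_ofReal_mul, ← mul_inv,
        Real.mul_self_sqrt (hpos n).le, inv_mul_eq_div]
    simp_rw [h1]
    have h2 : Tendsto (fun n ↦ (weilQuadratic (o' n)).re / Nn n) atTop (𝓝 (ε * ν / ν)) :=
      hQ.div hN hνpos.ne'
    rw [mul_div_assoc, div_self hνpos.ne', mul_one] at h2
    exact (tendsto_add_atTop_iff_nat N₀).2 h2

end Summit.RiemannHypothesis.RiemannHypothesis.Theorems

end
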